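import Summits.QuantumFields.BalabanUV.Beta.EriceRemainderEnclosureHistoryAutonomyComparisonAgeCompositionThreeAgesMassCap

/-!
# EriceRemainderEnclosureHistoryAutonomyComparisonAgeCompositionWindowShares — (E90b) route (N), first order: THE LEVEL GEOMETRY BEHIND THE SHARE FUNCTIONAL along every
# box solution of an isotone memory with floor — STRICT LOG-CONVEXITY of the trajectory (`h(n+1)² < h(n)h(n+2)`, ratio and four-point forms, hence the
# correlations `C_{ij} < 1` and the sub-Markov inequality `C₁₃ ≤ C₁₂C₂₃`), CONCAVITY FROM ANY PIN (`j·a_{m+j+k} ≤ (j+k)·a_{m+j}`), THE SHARED WINDOW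
# (`n·Σ_i L_ih(m+n+i) ≤ 1∕h(m+n)² − 1∕h(m)²`), and LOAD ≤ SHARE: `k·L_kh(m+k)³∕2 ≤ s_k·h(m+k)∕(2h(m+2k)) ≤ (√2∕2)·s_k` with
# `s_k = L_kh(m+2k)∕Σ_i L_ih(m+k+i)` the age's share of the reads of its own window — the rise-free form of the window constraints

Cell `pub-balaban`, β-function sub-cell, BINDER row D4 «RemainderConst leaves for Bałaban's split» (`HOME/BINDER-OWNERS.md`; owner lineage `b2b-balaban-beta-an4`;
this file by co-owner #2 lineage `b2b-balaban-beta-d4-p2`, generation 81), β-FLOW TEAM duty (1), FREEZE (0) honoured (def-free; nothing restated).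

HONEST FRAMING (page 1, verbatim and binding).  *"Discharging BetaPertH makes Bałaban's UV stability UNCONDITIONAL — a real constructive-QFT result; it is
NOT the continuum limit and NOT the Clay problem."*  THIS FILE DISCHARGES NOTHING OF THE KIND.  Elementary real algebra ∕ real analysis about ABSTRACT
functionals on a box ]0,γ]^ℕ with displayed floors, profiles and signs, and the FIRST-ORDER renewal objects of route (N) built from them — hypotheses of a
census, not facts; the form, signs, ages and moments of Bałaban's (1.22) limit functional are NOT PRINTED ([I] p. 298; GAPS G-t4-U2-1∕-2) and NOT asserted.
Row D4 class UNCHANGED (critical-path width 0; instance 0∕1; D4 DISCHARGE NO DATE).  HONEST DEPENDENCY: continuum YM on T⁴ ⇐ BetaPertH ∧ nine spine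
estimates (0/9 proved); BetaPertH ⇐ (D1) ∧ (D4) ∧ CAP+tail; G-an2-4 gates asym, D1 and NE2/3/4.

THE POINT (README `HOME/b2b-balaban-beta-d4-p2/g81/e90/README.md` §2–§3).  The three summed windows `n ∈ {1,k₂,k₃}` of (E88d)∕(E89b) bound the total
window load by a linear programme whose value depends on the rises `A_n = 1∕h(m+n)² − 1∕h(m)²`; normalising each age by its OWN window
(`x_k = W_k·u_k`, `W_k ≤ √2∕2` by (E89b)) and observing `n·D_n ≤ A_n` for the window reads `D_n = Σ_i L_ih(m+n+i)` gives `u_k ≤ s_k` — the rises drop out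
and only the kernel `h(m+n_i+n_j)` of the log-convex trajectory remains; (E90a) `…ShareAlgebra` bounds the resulting share sums, (E90c)
`…ThreeAgesTotalLoad` assembles the theorems.  Uses (E75) `increment_anti` ∕ `mul_invSq_add_le`, (E79) `strictAnti_of_memFlow` ∕ `memFlow_tail`, (E88d)
`invSq_sub_ge_all_reads`, (E89b) `window_ratio_sq_le` BY NAME.  NOT CLAIMED: anything printed — NOT B12 Thm 2, NOT BetaPertH.

WHAT IS PROVED ([folklore]; 0 `def`, 0 sorry).  §1 `sq_lt_mul_succ`, `ratio_le`, `ratio_lt`, `mul_le_mul_outer`, `mul_lt_mul_outer`, `mul_invSq_le_from_pin`,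
`mul_sq_le_from_pin`, `le_sqrt_two_mul`; §2 `window_reads_le`, `load_le_share_mul`, `load_le_share`.
-/
noncomputable section
open Finset

namespace Summit.QuantumFields.BalabanUV.Beta.EriceRemainderEnclosureHistoryAutonomyComparisonAgeCompositionWindowShares

open Literature.MathematicalPhysics.QuantumFieldTheory.Balaban1983to89
open Literature.MathematicalPhysics.QuantumFieldTheory.Balaban1983to89.T4BetaStationary
open Literature.MathematicalPhysics.QuantumFieldTheory.Balaban1983to89.T4BetaFlowWellPosed
open Summit.QuantumFields.BalabanUV.Beta.EriceRemainderEnclosureHistoryAutonomyOrder (strictAnti_of_memFlow memFlow_tail)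
open Summit.QuantumFields.BalabanUV.Beta.EriceRemainderEnclosureHistoryAutonomyComparisonAffineProfile (increment_anti mul_invSq_add_le)
open Summit.QuantumFields.BalabanUV.Beta.EriceRemainderEnclosureHistoryAutonomyComparisonAgeCompositionThreeAgesFlowReads (invSq_sub_ge_all_reads)
open Summit.QuantumFields.BalabanUV.Beta.EriceRemainderEnclosureHistoryAutonomyComparisonAgeCompositionThreeAgesMassCap (window_ratio_sq_le)

variable {B : (ℕ → ℝ) → ℝ} {γ b gIR : ℝ} {L : ℕ → ℝ} {K : ℕ} {h : ℕ → ℝ}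

/-! ## §1 Strict log-convexity of the levels, concavity from any pin -/

/-- **STRICT LOG-CONVEXITY OF THE LEVELS**: `h(n+1)² < h(n)·h(n+2)` along every box solution of an isotone memory with floor `b > 0`
(increments of `1∕h²` positive and non-increasing ⟹ `1∕h²` strictly log-concave). [folklore] -/
theorem sq_lt_mul_succ (hmono : ∀ u v : ℕ → ℝ, SeqBox γ u → SeqBox γ v → (∀ j, u j ≤ v j) → B u ≤ B v) (hb : 0 < b)
    (hlo : ∀ u, SeqBox γ u → b ≤ B u) (hh : SeqBox γ h) (hf : MemFlow B gIR h) (n : ℕ) :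
    h (n + 1) ^ 2 < h n * h (n + 2) := by
  have hpos : ∀ n, 0 < h n := fun n => (hh n).1
  have h0 := hpos n; have h1 := hpos (n + 1); have h2 := hpos (n + 2)
  have e1 := hf.2 n
  have e2 : 1 / h (n + 2) ^ 2 = 1 / h (n + 1) ^ 2 + B (fun j => h (n + 1 + 1 + j)) := hf.2 (n + 1)
  have hanti : B (fun j => h (n + 1 + 1 + j)) ≤ B (fun j => h (n + 1 + j)) := increment_anti hmono hb hlo hh hf (Nat.le_succ n)
  have hBpos : 0 < B (fun j => h (n + 1 + 1 + j)) := lt_of_lt_of_le hb (hlo _ (seqBox_shift hh (n + 1 + 1)))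
  have ha0 : 0 < 1 / h n ^ 2 := by positivity
  -- a₀·a₂ < a₁² for the levels a = 1∕h²
  have key : (1 / h n ^ 2) * (1 / h (n + 2) ^ 2) < (1 / h (n + 1) ^ 2) * (1 / h (n + 1) ^ 2) := by
    nlinarith [mul_nonneg ha0.le (sub_nonneg.2 hanti), mul_pos hBpos (lt_of_lt_of_le hb (hlo _ (seqBox_shift hh (n + 1))))]
  have key2 : h (n + 1) ^ 2 * h (n + 1) ^ 2 < h n ^ 2 * h (n + 2) ^ 2 := by
    rw [div_mul_div_comm, div_mul_div_comm, one_mul, one_div_lt_one_div (by positivity) (by positivity)] at key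
    exact key
  have key' : (h (n + 1) ^ 2) ^ 2 < (h n * h (n + 2)) ^ 2 := by rw [sq (h (n + 1) ^ 2), mul_pow]; exact key2
  exact lt_of_pow_lt_pow_left₀ 2 (by positivity) key'

/-- Ratio monotonicity: `h(n+1)·h(n+d) ≤ h(n)·h(n+d+1)` (the ratios `h(n+1)∕h(n)` do not decrease). [folklore] -/
theorem ratio_le (hmono : ∀ u v : ℕ → ℝ, SeqBox γ u → SeqBox γ v → (∀ j, u j ≤ v j) → B u ≤ B v) (hb : 0 < b)
    (hlo : ∀ u, SeqBox γ u → b ≤ B u) (hh : SeqBox γ h) (hf : MemFlow B gIR h) (n d : ℕ) :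
    h (n + 1) * h (n + d) ≤ h n * h (n + d + 1) := by
  have hpos : ∀ n, 0 < h n := fun n => (hh n).1
  induction d with
  | zero => simp [mul_comm]
  | succ d ih =>
    have hs := (sq_lt_mul_succ hmono hb hlo hh hf (n + d)).le
    rw [show n + (d + 1) = n + d + 1 by ring, show n + d + 1 + 1 = n + d + 2 by ring]
    have hp1 := hpos (n + d); have hp2 := hpos (n + d + 1)
    -- ih × hs, cancel h(n+d)·h(n+d+1)
    nlinarith [mul_le_mul ih hs (sq_nonneg _) (mul_pos (hpos n) hp2).le, mul_pos hp1 hp2, hpos (n + 1), hpos (n + d + 2)]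

/-- Strict ratio monotonicity across a positive gap: `h(n+1)·h(n+d) < h(n)·h(n+d+1)` for `d ≥ 1`. [folklore] -/
theorem ratio_lt (hmono : ∀ u v : ℕ → ℝ, SeqBox γ u → SeqBox γ v → (∀ j, u j ≤ v j) → B u ≤ B v) (hb : 0 < b)
    (hlo : ∀ u, SeqBox γ u → b ≤ B u) (hh : SeqBox γ h) (hf : MemFlow B gIR h) (n : ℕ) {d : ℕ} (hd : 1 ≤ d) :
    h (n + 1) * h (n + d) < h n * h (n + d + 1) := by
  have hpos : ∀ n, 0 < h n := fun n => (hh n).1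
  obtain ⟨d, rfl⟩ : ∃ d', d = d' + 1 := ⟨d - 1, by omega⟩
  have ih := ratio_le hmono hb hlo hh hf n d
  have hs := sq_lt_mul_succ hmono hb hlo hh hf (n + d)
  rw [show n + (d + 1) = n + d + 1 by ring, show n + d + 1 + 1 = n + d + 2 by ring]
  have hp1 := hpos (n + d); have hp2 := hpos (n + d + 1)
  nlinarith [mul_le_mul_of_nonneg_left ih hp2.le, mul_lt_mul_of_pos_left hs (hpos n), mul_pos hp1 (hpos n), hp1,
    hpos (n + 1), hpos (n + d + 2)]

/-- **FOUR-POINT LOG-CONVEXITY**: `h(p+d)·h(p+e) ≤ h(p)·h(p+d+e)` — inner products are at most outer products. [folklore] -/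
theorem mul_le_mul_outer (hmono : ∀ u v : ℕ → ℝ, SeqBox γ u → SeqBox γ v → (∀ j, u j ≤ v j) → B u ≤ B v) (hb : 0 < b)
    (hlo : ∀ u, SeqBox γ u → b ≤ B u) (hh : SeqBox γ h) (hf : MemFlow B gIR h) (p d e : ℕ) :
    h (p + d) * h (p + e) ≤ h p * h (p + d + e) := by
  have hpos : ∀ n, 0 < h n := fun n => (hh n).1
  induction e with
  | zero => simp [mul_comm]
  | succ e ih =>
    have hr := ratio_le hmono hb hlo hh hf (p + e) d
    rw [show p + e + d = p + d + e by ring] at hr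
    rw [show p + (e + 1) = p + e + 1 by ring, show p + d + (e + 1) = p + d + e + 1 by ring]
    have h1 := hpos (p + e); have h2 := hpos (p + d + e)
    nlinarith [mul_le_mul ih hr (mul_pos (hpos (p + e + 1)) h2).le (mul_pos (hpos p) h2).le, mul_pos h1 h2,
      hpos p, hpos (p + d), hpos (p + e + 1), hpos (p + d + e + 1)]

/-- Strict four-point log-convexity across positive gaps: `h(p+d)·h(p+e) < h(p)·h(p+d+e)` for `d, e ≥ 1`. [folklore] -/
theorem mul_lt_mul_outer (hmono : ∀ u v : ℕ → ℝ, SeqBox γ u → SeqBox γ v → (∀ j, u j ≤ v j) → B u ≤ B v) (hb : 0 < b)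
    (hlo : ∀ u, SeqBox γ u → b ≤ B u) (hh : SeqBox γ h) (hf : MemFlow B gIR h) (p : ℕ) {d e : ℕ} (hd : 1 ≤ d) (he : 1 ≤ e) :
    h (p + d) * h (p + e) < h p * h (p + d + e) := by
  have hpos : ∀ n, 0 < h n := fun n => (hh n).1
  obtain ⟨e, rfl⟩ : ∃ e', e = e' + 1 := ⟨e - 1, by omega⟩
  have ih := mul_le_mul_outer hmono hb hlo hh hf p d e
  have hr := ratio_lt hmono hb hlo hh hf (p + e) hd
  rw [show p + e + d = p + d + e by ring] at hr
  rw [show p + (e + 1) = p + e + 1 by ring, show p + d + (e + 1) = p + d + e + 1 by ring]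
  have h1 := hpos (p + e); have h2 := hpos (p + d + e)
  -- ih·h(p+e+1) ≤ …, hr·h(p) < …, cancel h(p+e)·h(p+d+e)
  nlinarith [mul_le_mul_of_nonneg_left ih (hpos (p + e + 1)).le, mul_lt_mul_of_pos_left hr (hpos p), mul_pos h1 h2,
    mul_pos (hpos p) h2, hpos (p + d), hpos (p + d + e + 1)]

/-- **CONCAVITY OF THE LEVELS FROM ANY PIN**: `j·(1∕h(m+j+k)²) ≤ (j+k)·(1∕h(m+j)²)` ((E75) `mul_invSq_add_le` for the tail solution from the pin
`h m`). [folklore] -/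
theorem mul_invSq_le_from_pin (hmono : ∀ u v : ℕ → ℝ, SeqBox γ u → SeqBox γ v → (∀ j, u j ≤ v j) → B u ≤ B v) (hb : 0 < b)
    (hlo : ∀ u, SeqBox γ u → b ≤ B u) (hh : SeqBox γ h) (hf : MemFlow B gIR h) (m j k : ℕ) :
    (j : ℝ) * (1 / h (m + j + k) ^ 2) ≤ ((j : ℝ) + k) * (1 / h (m + j) ^ 2) := by
  have := mul_invSq_add_le hmono hb hlo (hh m).1 (seqBox_shift hh m) (memFlow_tail hf m) j k
  simpa [Nat.add_assoc] using this

/-- Concavity from the pin in product form: `i·h(m+i)² ≤ (i+j)·h(m+i+j)²`. [folklore] -/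
theorem mul_sq_le_from_pin (hmono : ∀ u v : ℕ → ℝ, SeqBox γ u → SeqBox γ v → (∀ j, u j ≤ v j) → B u ≤ B v) (hb : 0 < b)
    (hlo : ∀ u, SeqBox γ u → b ≤ B u) (hh : SeqBox γ h) (hf : MemFlow B gIR h) (m i j : ℕ) :
    (i : ℝ) * h (m + i) ^ 2 ≤ ((i : ℝ) + j) * h (m + i + j) ^ 2 := by
  have hpos : ∀ n, 0 < h n := fun n => (hh n).1
  have h1 := hpos (m + i); have h2 := hpos (m + i + j)
  have := mul_invSq_le_from_pin hmono hb hlo hh hf m i j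
  rw [mul_one_div, mul_one_div, div_le_div_iff₀ (by positivity) (by positivity)] at this
  linarith

/-- `h(m+k) ≤ √2·h(m+2k)` along every flow ((E89b) `window_ratio_sq_le`). [folklore] -/
theorem le_sqrt_two_mul (hmono : ∀ u v : ℕ → ℝ, SeqBox γ u → SeqBox γ v → (∀ j, u j ≤ v j) → B u ≤ B v) (hb : 0 < b)
    (hlo : ∀ u, SeqBox γ u → b ≤ B u) (hh : SeqBox γ h) (hf : MemFlow B gIR h) (m k : ℕ) :
    h (m + k) ≤ Real.sqrt 2 * h (m + k + k) := by
  have hpos : ∀ n, 0 < h n := fun n => (hh n).1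
  have h0 := hpos m; have h1 := hpos (m + k); have h2 := hpos (m + k + k)
  have hs2 : Real.sqrt 2 ^ 2 = 2 := Real.sq_sqrt (by norm_num)
  have hr := window_ratio_sq_le hmono hb hlo hh hf m k
  rw [show m + 2 * k = m + k + k by ring, div_pow, div_le_iff₀ (by positivity)] at hr
  have hsq : h (m + k) ^ 2 ≤ (Real.sqrt 2 * h (m + k + k)) ^ 2 := by
    rw [mul_pow, hs2]; nlinarith [mul_nonneg (sq_nonneg (h (m + k) / h m)) (sq_nonneg (h (m + k + k)))]
  exact le_of_pow_le_pow_left₀ two_ne_zero (by positivity) hsq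

/-! ## §2 The shared window and load ≤ share -/

/-- **THE SHARED WINDOW**: `n·Σ_{i<K} L_i h(m+n+i) ≤ 1∕h(m+n)² − 1∕h(m)²` — every one of the `n` increments of `[m, m+n)` reads, at every age
`i`, a level at least `h(m+n+i)` ((E88d) `invSq_sub_ge_all_reads`; `L ≥ 0`). [folklore] -/
theorem window_reads_le (hL : ∀ k, 0 ≤ L k) (hb : 0 < b) (hlo : ∀ u, SeqBox γ u → b ≤ B u)
    (hdom : ∀ u, SeqBox γ u → ∑ k ∈ range K, L k * u k ≤ B u) (hh : SeqBox γ h) (hf : MemFlow B gIR h) (m n : ℕ) :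
    (n : ℝ) * ∑ i ∈ range K, L i * h (m + n + i) ≤ 1 / h (m + n) ^ 2 - 1 / h m ^ 2 := by
  have hanti := (strictAnti_of_memFlow hb hlo hh hf).antitone
  have hall := invSq_sub_ge_all_reads hdom hh hf m n
  have hq : ∀ q ∈ range n, ∑ i ∈ range K, L i * h (m + n + i) ≤ ∑ i ∈ range K, L i * h (m + q + 1 + i) := fun q hq =>
    sum_le_sum fun i _ => mul_le_mul_of_nonneg_left (hanti (by have := mem_range.mp hq; omega)) (hL i)
  have hs := sum_le_sum hq
  rw [sum_const, card_range, nsmul_eq_mul] at hs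
  exact hs.trans hall

/-- **THE LOAD OF AN AGE IS AT MOST ITS SHARE OF ITS OWN WINDOW, TIMES `h(m+k)∕(2h(m+2k))`**: with `D = Σ_{i<K} L_i h(m+k+i)` the reads of
window `k`, `k·L_k h(m+k)³∕2 ≤ (L_k h(m+2k)∕D)·(h(m+k)∕(2h(m+2k)))` (`k < K`; the share is `0` when `L_k = 0`). [folklore] -/
theorem load_le_share_mul (hL : ∀ k, 0 ≤ L k) (hb : 0 < b) (hlo : ∀ u, SeqBox γ u → b ≤ B u)
    (hdom : ∀ u, SeqBox γ u → ∑ k ∈ range K, L k * u k ≤ B u) (hh : SeqBox γ h) (hf : MemFlow B gIR h) {k : ℕ} (hkK : k < K) (m : ℕ) :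
    (k : ℝ) * (L k * h (m + k) ^ 3 / 2) ≤ (L k * h (m + 2 * k) / ∑ i ∈ range K, L i * h (m + k + i)) * (h (m + k) / (2 * h (m + 2 * k))) := by
  have hpos : ∀ n, 0 < h n := fun n => (hh n).1
  have h0 := hpos m; have h1 := hpos (m + k); have h2 := hpos (m + 2 * k)
  rcases (hL k).eq_or_lt with hLk | hLk
  · rw [← hLk]; simp
  have hDk : L k * h (m + 2 * k) ≤ ∑ i ∈ range K, L i * h (m + k + i) := by
    rw [show m + 2 * k = m + k + k by ring]
    exact single_le_sum (f := fun i => L i * h (m + k + i)) (fun i _ => mul_nonneg (hL i) (hpos _).le) (mem_range.mpr hkK)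
  have hD : 0 < ∑ i ∈ range K, L i * h (m + k + i) := lt_of_lt_of_le (mul_pos hLk h2) hDk
  have hw := window_reads_le hL hb hlo hdom hh hf m k
  have hm2 : 0 < 1 / h m ^ 2 := by positivity
  have hA : 1 / h (m + k) ^ 2 - 1 / h m ^ 2 ≤ 1 / h (m + k) ^ 2 := by linarith
  -- k·L_k·h(m+2k)·… = share · (k·D) ≤ share · 1∕h(m+k)²
  have hkD : (k : ℝ) * ∑ i ∈ range K, L i * h (m + k + i) ≤ 1 / h (m + k) ^ 2 := hw.trans hA
  rw [div_mul_div_comm, le_div_iff₀ (by positivity)]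
  have e : (k : ℝ) * (L k * h (m + k) ^ 3 / 2) * ((∑ i ∈ range K, L i * h (m + k + i)) * (2 * h (m + 2 * k)))
      = (L k * h (m + 2 * k) * h (m + k)) * (h (m + k) ^ 2 * ((k : ℝ) * ∑ i ∈ range K, L i * h (m + k + i))) := by ring
  rw [e]
  have : h (m + k) ^ 2 * ((k : ℝ) * ∑ i ∈ range K, L i * h (m + k + i)) ≤ 1 := by
    have := mul_le_mul_of_nonneg_left hkD (le_of_lt (pow_pos h1 2))
    rwa [show h (m + k) ^ 2 * (1 / h (m + k) ^ 2) = 1 by field_simp] at this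
  have hc : 0 ≤ L k * h (m + 2 * k) * h (m + k) := by positivity
  nlinarith [mul_le_mul_of_nonneg_left this hc]

/-- **… HENCE AT MOST `√2∕2` TIMES ITS SHARE** (`h(m+k) ≤ √2·h(m+2k)`, (E89b) `window_ratio_sq_le`). [folklore] -/
theorem load_le_share (hmono : ∀ u v : ℕ → ℝ, SeqBox γ u → SeqBox γ v → (∀ j, u j ≤ v j) → B u ≤ B v) (hL : ∀ k, 0 ≤ L k) (hb : 0 < b)
    (hlo : ∀ u, SeqBox γ u → b ≤ B u) (hdom : ∀ u, SeqBox γ u → ∑ k ∈ range K, L k * u k ≤ B u) (hh : SeqBox γ h) (hf : MemFlow B gIR h)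
    {k : ℕ} (hkK : k < K) (m : ℕ) :
    (k : ℝ) * (L k * h (m + k) ^ 3 / 2) ≤ Real.sqrt 2 / 2 * (L k * h (m + 2 * k) / ∑ i ∈ range K, L i * h (m + k + i)) := by
  have hpos : ∀ n, 0 < h n := fun n => (hh n).1
  have h1 := hpos (m + k); have h2 := hpos (m + 2 * k)
  have hs0 : 0 ≤ L k * h (m + 2 * k) / ∑ i ∈ range K, L i * h (m + k + i) :=
    div_nonneg (mul_nonneg (hL k) h2.le) (sum_nonneg fun i _ => mul_nonneg (hL i) (hpos _).le)
  have hrat : h (m + k) / (2 * h (m + 2 * k)) ≤ Real.sqrt 2 / 2 := by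
    have hr2 := window_ratio_sq_le hmono hb hlo hh hf m k
    have ht0 : 0 ≤ h (m + k) / h (m + 2 * k) := le_of_lt (div_pos h1 h2)
    have : h (m + k) / h (m + 2 * k) ≤ Real.sqrt 2 := by
      rw [← Real.sqrt_sq ht0]; exact Real.sqrt_le_sqrt (by nlinarith [sq_nonneg (h (m + k) / h m)])
    rw [show h (m + k) / (2 * h (m + 2 * k)) = (h (m + k) / h (m + 2 * k)) / 2 by rw [div_div, mul_comm]]
    linarith
  calc (k : ℝ) * (L k * h (m + k) ^ 3 / 2) ≤ (L k * h (m + 2 * k) / ∑ i ∈ range K, L i * h (m + k + i)) * (h (m + k) / (2 * h (m + 2 * k))) :=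
        load_le_share_mul hL hb hlo hdom hh hf hkK m
    _ ≤ (L k * h (m + 2 * k) / ∑ i ∈ range K, L i * h (m + k + i)) * (Real.sqrt 2 / 2) := mul_le_mul_of_nonneg_left hrat hs0
    _ = _ := by ring


end Summit.QuantumFields.BalabanUV.Beta.EriceRemainderEnclosureHistoryAutonomyComparisonAgeCompositionWindowShares

end
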